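import Literature.AnabelianGeometry.EtaleTheta.SettingModel
import Literature.AnabelianGeometry.EtaleTheta.Discharge.Sec1AutPreservesDeltaTemp
import Mathlib.GroupTheory.Abelianization.Defs
import Mathlib.Topology.Instances.ZMod
import HarnessLib

/-!
# A model of the [EtTh] §1 root, inversion profile: the pointed inversion `ι` at `ThetaSetting.model p`

S. Mochizuki, *The étale theta function and its Frobenioid-theoretic manifestations*, Publ. RIMS **45** (2009)
[EtTh]: §1 p. 12 (PRIMS p. 238) «`Δ_X` … a profinite free group on 2 generators», «a natural surjection `Π^tp_X ↠ Z`»;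
§2 p. 36 (PRIMS p. 262) «`ι` … the automorphism … determined by “multiplication by `−1`” on the underlying elliptic
curve»; Prop. 2.2 (i) p. 37 «eigenvalues `−1` and `1`». S. Mochizuki, *Inter-universal Teichmüller theory II* (kurims,
Dec. 2020) [IUTchII], Rmk. 1.4.1 (ii) p. 28 (the pointed inversion of `X̲̲_k`, an automorphism over `G_k`), Prop. 2.2 (ii)
pp. 65–67. [cite: MochizukiEtTh2009, §2 p.36]

Cell abc-iut, seat abc-iut-w5-d072 (gen 3; (R1) ι-datum custody, GAP row G-w4d010-2 / disposition D-G-w4d010-2h). The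
closing theorems for [IUTchII] Prop. 2.2 (ii) / Cor. 1.12 (ii) at the model of the étale theta data
(`Literature.IUT.HodgeArakelov.EtaleThetaDataOfSetting.Inversion.prop22_ii'_model_of_inversion_of_hinv`, p420219;
abc-iut-w4-d043's `EtaleLevels.cor112_ii_model`, p420795) bind ONE topological automorphism `ι` of `Π^tp_X` together
with the NAMED facets (R1b′) `hΔ : ι(Δ^tp_X) = Δ^tp_X`, `hq : IsQuotientMap toTheta` and the geometric facet
(R1e′) `hinv : ∀ g ∈ Δ_X, ι̂ g · g ∈ closure ⁅Δ_X, Δ_X⁆` («`ι̂` acts as `−1` on `Δ_X^ab`», `ι̂ = TemperedCurve.completionAut ι`),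
from which (R1c) «`ι` reverses `Z`» and (R1e) «`ι^Θ ≡ +1` on `Δ_Θ`» are DERIVED (p420219, p419214). abc-iut-w4-d014's
kernel probe (STATUS 04:35:03Z, P1) shows that these facets FAIL for the element `ε_±` of abc-iut-L2-t1's degenerate
`MuTwoSetting.model` (there `ε_±` is central). This file is the complementary **inversion profile of the ROOT model**
`ThetaSetting.model p` (abc-iut-L2-t1, `SettingModel.lean`: `Π^tp_X = F₂ × Γ` discrete, `Π_X = F̂₂ × Γ̂`, `Z`-quotient =
the `a`-exponent sum):

* §1 `invGenHom : F₂ →* F₂`, `a ↦ a⁻¹`, `b ↦ b⁻¹` — the inversion of the free group on the generators `a, b` of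
  `Δ^tp_X` (an involution); `hom_invGenHom`: every homomorphism to a commutative group is NEGATED by it, hence
  `invGenHom_mul_self_mem_commutator : σ(x)·x ∈ [F₂, F₂]` («`−1` on `Δ^ab`»).
* §2 **`SettingModel.inversion p : (ThetaSetting.model p).PiTemp ≃ₜ* (ThetaSetting.model p).PiTemp`** `:= σ × id` — the
  model's pointed inversion: an involution (`inversion_inversion`), nontrivial (`inversion_ne_refl`), OVER `G_{ℚ_p}`
  (`aug_inversion`), whence (R1b′)-hΔ BY NAME from abc-iut-w4-d014's `map_deltaTemp_eq_of_aug_comp` (p420905)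
  (`map_deltaTemp_inversion`), and REVERSING `Z` on the nose (`toZ_inversion`, the conclusion of (R1c)).
* §3 **(R1e′) holds**: `inversion_hinv : ∀ g ∈ Δ_X, ι̂ g · g ∈ closure ⁅Δ_X, Δ_X⁆` — kernel route without cohomology:
  the set `{g | ι̂ g · g ∈ closure ⁅Δ_X,Δ_X⁆}` is CLOSED in `Π_X` and contains `ι_X(Δ^tp_X)` (there `ι̂ ι_X x · ι_X x =
  ι_X(σx · x) ∈ ι_X ⁅Δ^tp_X, Δ^tp_X⁆`), whose closure IS `Δ_X` (root definition `TemperedCurve.DeltaHat`).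
* §4 **(R1e′) is NOT derivable from the root interface**: `not_hinv_refl` — the identity automorphism of the same model
  satisfies hΔ but not hinv (witness `ι_X(a)`: `ι_X(a)² ∉ closure ⁅Δ_X,Δ_X⁆`, detected by the `a`-exponent sum mod `3`
  extended to `Π_X` along the profinite completion) — packaged as `hinv_not_derivable :
  ¬ ∀ D ι, D.IsEtThOrigin → ι(Δ^tp) = Δ^tp → hinv`.
* §5 headline `ThetaSetting.exists_isEtThOrigin_inversion`: the inversion datum {`ι` involutive, `≠ 1`, over `G_K`, hΔ,
  hq, `Z`-reversal, hinv} is JOINTLY SATISFIABLE together with the origin guard `IsEtThOrigin` — so the hypotheses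
  (R1b′)/(R1e′) of the Prop. 2.2 (ii) closers quantify over an inhabited, non-degenerate domain, while §4 shows (R1e′) is
  genuine extra content (a candidate post-freeze root datum, not a theorem of `Setting.lean` v3).

HONEST LIMITS: consistency/independence evidence at the ROOT level only (the model carries no `KummerData` /
`DoubleUnderline`, so the facets (R1a) hι, (R1d) hind and the (R2)(R3) translate binders are not exercised here); the
model is degenerate along the tempered topology (discrete `Π^tp`), though the mechanism of §3 is the genuine one
(`−1` on `F̂₂^ab`). [EtTh] is refereed; nothing here bears on [IUTchIII] Cor. 3.12; typed ≠ proved; instantiated ≠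
endorsed. One new definition (`inversion`, plus its `F₂`/`Δ` avatars); no instances on existing types; no Prop facts.
-/

noncomputable section

namespace Literature.AnabelianGeometry.EtaleTheta.SettingModel

open Literature.AnabelianGeometry.SemiGraphs
open scoped commutatorElement
open _root_.Topology

/-! ## §1. The inversion `a ↦ a⁻¹`, `b ↦ b⁻¹` of the free group `F₂` -/

/-- **The inversion of `F₂` on its free generators**: `a ↦ a⁻¹`, `b ↦ b⁻¹` (the action of `[−1]` of the elliptic
curve on the two topological generators of `Δ_X`, [EtTh] §2 p. 36). [cite: MochizukiEtTh2009, §2 p.36] -/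
def invGenHom : F₂ →* F₂ := FreeGroup.lift fun i => (FreeGroup.of i)⁻¹

/-- `σ(xᵢ) = xᵢ⁻¹`. [cite: MochizukiEtTh2009, §2 p.36] -/
@[simp] theorem invGenHom_of (i : Fin 2) : invGenHom (FreeGroup.of i) = (FreeGroup.of i)⁻¹ :=
  FreeGroup.lift_apply_of

/-- `σ ∘ σ = id`. [cite: MochizukiEtTh2009, §2 p.36] -/
theorem invGenHom_comp_invGenHom : invGenHom.comp invGenHom = MonoidHom.id F₂ := by
  ext i
  simp

/-- `σ(σ(x)) = x`. [cite: MochizukiEtTh2009, §2 p.36] -/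
@[simp] theorem invGenHom_invGenHom (x : F₂) : invGenHom (invGenHom x) = x :=
  DFunLike.congr_fun invGenHom_comp_invGenHom x

/-- **`σ` acts as `−1` on every commutative quotient**: for a homomorphism `χ : F₂ → A` to a commutative group,
`χ(σ x) = χ(x)⁻¹` («multiplication by `−1`» on `Δ_X^ab`, [EtTh] p. 36; Prop. 2.2 (i) eigenvalue `−1`).
[cite: MochizukiEtTh2009, Prop 2.2 (i) p.37] -/
theorem hom_invGenHom {A : Type*} [CommGroup A] (χ : F₂ →* A) (x : F₂) : χ (invGenHom x) = (χ x)⁻¹ := by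
  have h : χ.comp invGenHom = invMonoidHom.comp χ := by
    ext i
    simp
  exact DFunLike.congr_fun h x

/-- **`σ(x)·x ∈ [F₂, F₂]`** for every `x ∈ F₂` (via the abelianisation: `σ` is `−1` there).
[cite: MochizukiEtTh2009, Prop 2.2 (i) p.37] -/
theorem invGenHom_mul_self_mem_commutator (x : F₂) : invGenHom x * x ∈ commutator F₂ := by
  rw [← Abelianization.ker_of, MonoidHom.mem_ker, map_mul, hom_invGenHom, inv_mul_cancel]

variable (p : ℕ) [Fact p.Prime]

/-- The inversion on the model's discrete geometric factor `Δ = F₂` (type synonym `Del`), as a multiplicative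
equivalence. [cite: MochizukiEtTh2009, §2 p.36] -/
def Del.inv : Del ≃* Del where
  toFun g := Del.ofF₂ (invGenHom (Del.val g))
  invFun g := Del.ofF₂ (invGenHom (Del.val g))
  left_inv g := by
    change Del.ofF₂ (invGenHom (invGenHom (Del.val g))) = g
    rw [invGenHom_invGenHom]
    rfl
  right_inv g := by
    change Del.ofF₂ (invGenHom (invGenHom (Del.val g))) = g
    rw [invGenHom_invGenHom]
    rfl
  map_mul' a b := by simp only [map_mul]

/-- `val (Δ.inv g) = σ (val g)`. [cite: MochizukiEtTh2009, §2 p.36] -/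
@[simp] theorem Del.val_inv (g : Del) : Del.val (Del.inv g) = invGenHom (Del.val g) := rfl

/-- `Δ.inv (Δ.inv g) = g`. [cite: MochizukiEtTh2009, §2 p.36] -/
@[simp] theorem Del.inv_inv (g : Del) : Del.inv (Del.inv g) = g := (Del.inv).left_inv g

/-- `Δ.inv g · g ∈ [Δ, Δ]`. [cite: MochizukiEtTh2009, Prop 2.2 (i) p.37] -/
theorem Del.inv_mul_self_mem_commutator (g : Del) : Del.inv g * g ∈ commutator Del :=
  invGenHom_mul_self_mem_commutator (Del.val g)

/-! ## §2. The pointed inversion of the root model `ι := σ × id` on `Π^tp_X = Δ × Γ` -/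

/-- `ι := σ × id` on `Π^tp_X = Δ × Γ` as a topological automorphism (everything is discrete).
[cite: MochizukiEtTh2009, §2 p.36] -/
def inversionM : PiTp p ≃ₜ* PiTp p where
  toMulEquiv := (Del.inv).prodCongr (MulEquiv.refl (Gam p))
  continuous_toFun := continuous_of_discreteTopology
  continuous_invFun := continuous_of_discreteTopology

/-- **The pointed inversion of the root model** `ThetaSetting.model p`: the topological automorphism `σ × id` of
`Π^tp_X = F₂ × G_{ℚ_p}` inverting the two free generators of `Δ^tp_X` and fixing the Galois factor ([IUTchII]
Rmk. 1.4.1 (ii): the inversion of `X̲̲_k` is an automorphism of `Π^tp` over `G_k`; [EtTh] p. 36). DEFINED.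
[cite: Mochizuki2012, Rmk 1.4.1 (ii) p.28] -/
def inversion : (ThetaSetting.model p).PiTemp ≃ₜ* (ThetaSetting.model p).PiTemp := inversionM p

/-- `ι (d, γ) = (σ d, γ)`. [cite: MochizukiEtTh2009, §2 p.36] -/
@[simp] theorem inversion_apply (g : PiTp p) : inversion p g = (Del.inv g.1, g.2) := rfl

/-- **`ι` is an involution**: `ι (ι g) = g`. [cite: MochizukiEtTh2009, §2 p.36] -/
@[simp] theorem inversion_inversion (g : PiTp p) : inversion p (inversion p g) = g :=
  Prod.ext (Del.inv_inv g.1) rfl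

/-- **`ι` is over `G_{ℚ_p}`**: `aug ∘ ι = aug` ([IUTchII] Rmk. 1.4.1 (ii) «over `G_k`»). [cite: Mochizuki2012, Rmk 1.4.1 (ii) p.28] -/
theorem aug_inversion (g : PiTp p) : (ThetaSetting.model p).aug (inversion p g) = (ThetaSetting.model p).aug g := rfl

/-- **(R1b′)-hΔ at the root model**: `ι(Δ^tp_X) = Δ^tp_X` — BY NAME from abc-iut-w4-d014's
`TemperedCurve.map_deltaTemp_eq_of_aug_comp` (p420905), since `ι` is over `G_{ℚ_p}`. [cite: Mochizuki2012, Rmk 1.4.1 (ii) p.28] -/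
theorem map_deltaTemp_inversion :
    (ThetaSetting.model p).DeltaTemp.map (inversion p).toMulEquiv.toMonoidHom = (ThetaSetting.model p).DeltaTemp :=
  (ThetaSetting.model p).toTemperedCurve.map_deltaTemp_eq_of_aug_comp (inversion p) (aug_inversion p)

/-- **`ι` reverses `Z` on the nose**: `toZ (ι g) = (toZ g)⁻¹` for EVERY `g ∈ Π^tp_X` (the `a`-exponent sum is negated) —
the conclusion of facet (R1c) «`ι` reverses `Z`» ([IUTchII] Prop. 2.2 (ii); derived in general from (R1e′) in p420219).
[cite: Mochizuki2012, Prop 2.2 (ii) p.66] -/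
theorem toZ_inversion (g : PiTp p) :
    (ThetaSetting.model p).toZ (inversion p g) = ((ThetaSetting.model p).toZ g)⁻¹ := by
  change toZM p (inversion p g) = (toZM p g)⁻¹
  rw [toZM_apply, toZM_apply, inversion_apply, Del.val_inv]
  have h := hom_invGenHom (Heis.xHom.comp heisHom) (Del.val g.1)
  simpa using h

/-- The generator `a = x₀` of `Δ^tp_X`, as an element `(a, 1)` of `Π^tp_X`. [cite: MochizukiEtTh2009, §1 p.12] -/
def genA : PiTp p := (Del.ofF₂ (FreeGroup.of 0), 1)

/-- `toZ (a, 1) = 1 ∈ ℤ` (the `a`-exponent sum of `a`). [cite: MochizukiEtTh2009, §1 p.12] -/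
theorem toZ_genA : (ThetaSetting.model p).toZ (genA p) = Multiplicative.ofAdd 1 := by
  change toZM p (genA p) = _
  rw [toZM_apply]
  simp [genA, Del.val_ofF₂]

/-- `(a, 1) ∈ Δ^tp_X`. [cite: MochizukiEtTh2009, §1 p.12] -/
theorem genA_mem_deltaTemp : genA p ∈ (ThetaSetting.model p).DeltaTemp :=
  (mem_deltaTemp_iff p _).mpr rfl

/-- **`ι ≠ 1`**: the inversion is a nontrivial automorphism (it negates `toZ`, which takes the value `1`).
[cite: MochizukiEtTh2009, §2 p.36] -/
theorem inversion_ne_refl : inversion p ≠ ContinuousMulEquiv.refl (ThetaSetting.model p).PiTemp := by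
  intro h
  have h1 := toZ_inversion p (genA p)
  have h2 : inversion p (genA p) = genA p := by rw [h]; rfl
  rw [h2, toZ_genA, ← ofAdd_neg] at h1
  have h3 : (1 : ℤ) = -1 := Multiplicative.ofAdd.injective h1
  omega

/-! ## §3. (R1e′) at the root model: `ι̂` acts as `−1` on `Δ_X^ab` -/

/-- `ι x · x ∈ ⁅Δ^tp_X, Δ^tp_X⁆` for `x ∈ Δ^tp_X = Δ × 1` (from §1 through the embedding `Δ ↪ Δ × Γ`).
[cite: MochizukiEtTh2009, Prop 2.2 (i) p.37] -/
theorem inversion_mul_self_mem_commutator_deltaTemp {x : PiTp p} (hx : x ∈ (ThetaSetting.model p).DeltaTemp) :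
    inversion p x * x ∈ ⁅(ThetaSetting.model p).DeltaTemp, (ThetaSetting.model p).DeltaTemp⁆ := by
  have hx2 : x.2 = 1 := (mem_deltaTemp_iff p x).mp hx
  -- the embedding `Δ ↪ Δ × Γ` lands in `Δ^tp_X`
  have hinl : (⊤ : Subgroup Del).map (MonoidHom.inl Del (Gam p)) ≤ (ThetaSetting.model p).DeltaTemp := by
    rintro _ ⟨d, -, rfl⟩
    exact (mem_deltaTemp_iff p _).mpr rfl
  have hmem : MonoidHom.inl Del (Gam p) (Del.inv x.1 * x.1) ∈
      ⁅(ThetaSetting.model p).DeltaTemp, (ThetaSetting.model p).DeltaTemp⁆ := by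
    refine Subgroup.commutator_mono hinl hinl ?_
    rw [← Subgroup.map_commutator, ← commutator_def]
    exact ⟨_, Del.inv_mul_self_mem_commutator x.1, rfl⟩
  have heq : inversion p x * x = MonoidHom.inl Del (Gam p) (Del.inv x.1 * x.1) := by
    change (Del.inv x.1 * x.1, x.2 * x.2) = (Del.inv x.1 * x.1, 1)
    rw [hx2, mul_one]
  rw [heq]
  exact hmem

/-- **(R1e′) «`ι̂` acts as `−1` on `Δ_X^ab`» HOLDS at the root model**: for every `g ∈ Δ_X`,
`ι̂(g)·g ∈ closure ⁅Δ_X, Δ_X⁆`, `ι̂ = completionAut ι` the automorphism of `Π_X = F̂₂ × Γ̂` extending `ι` — the binder `hinv`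
of `prop22_ii'_model_of_inversion_of_hinv` (p420219) and of abc-iut-w4-d014's (R1e) derivation (p419214). Route: the set
of such `g` is closed in `Π_X` and contains the dense `ι_X(Δ^tp_X)`. [cite: MochizukiEtTh2009, Prop 2.2 (i) p.37] -/
theorem inversion_hinv : ∀ g ∈ (ThetaSetting.model p).DeltaHat,
    (ThetaSetting.model p).completionAut (inversion p) g * g ∈
      (⁅(ThetaSetting.model p).DeltaHat, (ThetaSetting.model p).DeltaHat⁆).topologicalClosure := by
  set X : TemperedCurve p := (ThetaSetting.model p).toTemperedCurve with hX
  set C : Subgroup X.PiHat := (⁅X.DeltaHat, X.DeltaHat⁆).topologicalClosure with hC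
  -- the set `S = {g | ι̂ g · g ∈ C}` is closed
  have hS : IsClosed {g : X.PiHat | X.completionAut (inversion p) g * g ∈ C} :=
    (Subgroup.isClosed_topologicalClosure _).preimage
      ((X.completionAut (inversion p)).continuous.mul continuous_id)
  -- and contains `ι_X(Δ^tp_X)`
  have hsub : ((X.DeltaTemp.map X.toHat.toMonoidHom : Subgroup X.PiHat) : Set X.PiHat) ⊆
      {g : X.PiHat | X.completionAut (inversion p) g * g ∈ C} := by
    rintro _ ⟨x, hx, rfl⟩
    change X.completionAut (inversion p) (X.toHat x) * X.toHat x ∈ C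
    rw [TemperedCurve.completionAut_toHat, ← map_mul]
    have h1 : X.toHat (inversion p x * x) ∈ (⁅X.DeltaTemp, X.DeltaTemp⁆).map X.toHat.toMonoidHom :=
      ⟨_, inversion_mul_self_mem_commutator_deltaTemp p hx, rfl⟩
    rw [Subgroup.map_commutator] at h1
    exact Subgroup.le_topologicalClosure _
      (Subgroup.commutator_mono (Subgroup.le_topologicalClosure _) (Subgroup.le_topologicalClosure _) h1)
  -- hence contains its closure `Δ_X`
  intro g hg
  have hg' : g ∈ closure ((X.DeltaTemp.map X.toHat.toMonoidHom : Subgroup X.PiHat) : Set X.PiHat) := by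
    rw [← Subgroup.topologicalClosure_coe]
    exact hg
  exact closure_minimal hsub hS hg'

/-! ## §4. (R1e′) is not derivable from the root interface: the identity automorphism fails it -/

/-- The `a`-exponent sum modulo `3`, `Π^tp_X → ℤ/3` (multiplicative notation), a continuous homomorphism on the
discrete `Π^tp_X`. [cite: MochizukiEtTh2009, §1 p.12] -/
def toZMod3 : PiTp p →ₜ* Multiplicative (ZMod 3) where
  toMonoidHom := (Int.castAddHom (ZMod 3)).toMultiplicative.comp (toZM p)
  continuous_toFun := continuous_of_discreteTopology

/-- `toZMod3 g = (toZ g mod 3)`. [cite: MochizukiEtTh2009, §1 p.12] -/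
theorem toZMod3_apply (g : PiTp p) :
    toZMod3 p g = Multiplicative.ofAdd (((Multiplicative.toAdd (toZM p g) : ℤ) : ZMod 3)) := rfl

/-- **`ι_X(a)² ∉ closure ⁅Δ_X, Δ_X⁆`**: the `a`-exponent sum mod `3` extends along the profinite completion to a
continuous character of `Π_X` killing the closure of `⁅Δ_X,Δ_X⁆` but taking the value `2 ≠ 0` on `ι_X(a)²`.
[cite: MochizukiEtTh2009, §1 p.12] -/
theorem toHat_genA_sq_not_mem_closure_commutator :
    (ThetaSetting.model p).toHat (genA p * genA p) ∉
      (⁅(ThetaSetting.model p).DeltaHat, (ThetaSetting.model p).DeltaHat⁆).topologicalClosure := by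
  set X : TemperedCurve p := (ThetaSetting.model p).toTemperedCurve with hX
  intro hmem
  haveI : CompactSpace (Multiplicative (ZMod 3)) := Finite.compactSpace
  obtain ⟨Φ, hΦ⟩ := IsProfiniteCompletion.exists_extension X.isProfiniteCompletion_toHat (toZMod3 p)
  -- `Φ` kills the closure of `⁅Δ_X, Δ_X⁆`
  have hker : (⁅X.DeltaHat, X.DeltaHat⁆).topologicalClosure ≤ Φ.toMonoidHom.ker := by
    refine Subgroup.topologicalClosure_minimal _ ?_ ?_
    · exact (Subgroup.commutator_mono le_top le_top).trans
        (by rw [← commutator_def]; exact Abelianization.commutator_subset_ker Φ.toMonoidHom)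
    · exact isClosed_singleton.preimage Φ.continuous
  have h1 : Φ (X.toHat (genA p * genA p)) = 1 := hker hmem
  rw [hΦ, map_mul] at h1
  have h2 : toZMod3 p (genA p) = Multiplicative.ofAdd 1 := by
    rw [toZMod3_apply]
    change Multiplicative.ofAdd (((Multiplicative.toAdd ((ThetaSetting.model p).toZ (genA p)) : ℤ) : ZMod 3)) = _
    rw [toZ_genA]
    simp
  rw [h2] at h1
  exact absurd (Multiplicative.ofAdd.injective
    (show Multiplicative.ofAdd ((1 : ZMod 3) + 1) = Multiplicative.ofAdd 0 from h1)) (by decide)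

/-- **The identity automorphism of the root model does NOT satisfy (R1e′)** (although it satisfies hΔ trivially):
`g := ι_X(a)` gives `ĝ·g = ι_X(a²) ∉ closure ⁅Δ_X,Δ_X⁆`. [cite: MochizukiEtTh2009, Prop 2.2 (i) p.37] -/
theorem not_hinv_refl : ¬ ∀ g ∈ (ThetaSetting.model p).DeltaHat,
    (ThetaSetting.model p).completionAut (ContinuousMulEquiv.refl _) g * g ∈
      (⁅(ThetaSetting.model p).DeltaHat, (ThetaSetting.model p).DeltaHat⁆).topologicalClosure := by
  intro h
  have h1 := h _ (toHat_mem_deltaHat_of_mem_deltaTemp p (genA_mem_deltaTemp p))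
  rw [TemperedCurve.completionAut_toHat, ContinuousMulEquiv.coe_refl, ← map_mul] at h1
  exact toHat_genA_sq_not_mem_closure_commutator p h1

/-- **(R1e′) is genuine extra content, not a theorem of the root interface**: it is NOT the case that every
topological automorphism `ι` of `Π^tp_X` over a §1 setting with the origin guard and with `ι(Δ^tp_X) = Δ^tp_X` acts as
`−1` on `Δ_X^ab` — witness: the identity of `ThetaSetting.model p`. (The root-interface twin of abc-iut-w4-d014's
observation that `MuTwoSetting`'s fields do not make `ε_±` an inversion.) [cite: MochizukiEtTh2009, Prop 2.2 (i) p.37] -/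
theorem hinv_not_derivable : ¬ ∀ (D : ThetaSetting p) (ι : D.PiTemp ≃ₜ* D.PiTemp), D.IsEtThOrigin →
    D.DeltaTemp.map ι.toMulEquiv.toMonoidHom = D.DeltaTemp →
    ∀ g ∈ D.DeltaHat, D.completionAut ι g * g ∈ (⁅D.DeltaHat, D.DeltaHat⁆).topologicalClosure := by
  intro h
  refine not_hinv_refl p (h (ThetaSetting.model p) (ContinuousMulEquiv.refl _)
    (ThetaSetting.model_isEtThOrigin p) ?_)
  exact (ThetaSetting.model p).toTemperedCurve.map_deltaTemp_eq_of_aug_comp _ fun _ => rfl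

/-! ## §5. Joint satisfiability of the inversion datum with the origin guard -/

/-- **The (R1) inversion datum is consistent with the [EtTh] §1 root interface and its origin guard.** There is a
theta setting `D` with `D.IsEtThOrigin` and a topological automorphism `ι` of `Π^tp_X` which is a nontrivial involution
over `G_K`, satisfies (R1b′) `ι(Δ^tp_X) = Δ^tp_X` and `IsQuotientMap toTheta`, reverses `Z`, and satisfies (R1e′)
«`ι̂ ≡ −1` on `Δ_X^ab`» — witness `ThetaSetting.model p` with `SettingModel.inversion p`. So the named hypotheses
(R1b′)/(R1e′) of the [IUTchII] Prop. 2.2 (ii) / Cor. 1.12 (ii) model closers quantify over an inhabited domain; by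
`hinv_not_derivable` the facet (R1e′) is independent of the root interface. [cite: Mochizuki2012, Prop 2.2 (ii) p.66] -/
theorem _root_.Literature.AnabelianGeometry.EtaleTheta.ThetaSetting.exists_isEtThOrigin_inversion :
    ∃ (D : ThetaSetting p) (ι : D.PiTemp ≃ₜ* D.PiTemp), D.IsEtThOrigin ∧
      ι ≠ ContinuousMulEquiv.refl D.PiTemp ∧ (∀ g, ι (ι g) = g) ∧ (∀ g, D.aug (ι g) = D.aug g) ∧
      D.DeltaTemp.map ι.toMulEquiv.toMonoidHom = D.DeltaTemp ∧ IsQuotientMap D.toTheta ∧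
      (∀ g, D.toZ (ι g) = (D.toZ g)⁻¹) ∧
      ∀ g ∈ D.DeltaHat, D.completionAut ι g * g ∈ (⁅D.DeltaHat, D.DeltaHat⁆).topologicalClosure := by
  refine ⟨ThetaSetting.model p, inversion p, ThetaSetting.model_isEtThOrigin p, inversion_ne_refl p,
    inversion_inversion p, aug_inversion p, map_deltaTemp_inversion p, ?_, toZ_inversion p, inversion_hinv p⟩
  -- `toTheta = Π^tp_X ↠ Π^tp_X / KTheta` is the quotient map of a discrete group
  exact QuotientGroup.isQuotientMap_mk (KTheta p)

end Literature.AnabelianGeometry.EtaleTheta.SettingModel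

end
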